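import Mathlib
import HarnessLib
import HarnessLib.Audit
import Summits.KontsevichZagierPeriods.Statement
import Literature.ModelTheory.ExponentialFields.DecidableTheory
import Literature.NumberTheory.Transcendental.KZCalculusOver
import Literature.NumberTheory.Transcendental.KZProduct

/-!
Route: DefinableMoves

DORMANT since 2026-09-04T05:10:19Z (reconciler: no traction for 5 d (last activity statement-checked at 2026-08-30T04:31:34Z); parked, not closed — `ledger route dormant route-KontsevichZagierPeriods-DefinableMoves --off` to reactivate) — unstaffed, not closed; items shared with open routes are served there. `ledger route dormant <id> --off` reactivates.

Route DefinableMoves — KontsevichZagierPeriods; realises idea card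
definable-move-relation-tarski-transfer ("the proof relation is semialgebraic").

THESIS X (it suffices to show X = RealKZ): any two ℚ-rational integral representations with the same
value are connected by finitely many instances of rules 1)–3) of the tree's calculus whose
INTERMEDIATE data — domains, integrands, change-of-variable maps Φ, primitives F, fibre bounds a ≤ b
— are semialgebraic over ℝ (arbitrary real parameters) instead of over ℚ. X →
KontsevichZagierPeriods is the TRANSFER THEOREM (crux #3): an ℝ-chain between ℚ-endpoints can be
replaced by a ℚ-chain, because (i) validity of a chain TEMPLATE is a first-order condition on its
real coefficient vector over (ℝ,+,·,≤) — every side condition of the four move sets (set identities,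
EqOn, InjOn, image, fibrewise continuity, HasDerivAt / HasFDerivWithinAt by ε-δ, a ≤ b, band shape;
null overlap = empty interior) is first-order EXCEPT absolute integrability of the intermediate
representations, whose locus in a ℚ-semialgebraic family is ℚ-semialgebraic (IntegrabilityLocus,
crux #2 — the one printed-but-unvendored input: ComteLionRolin2000 Prop. 1 via bi-Lipschitz
triviality, Kaiser2013); (ii) a nonempty ℚ-semialgebraic set has a real-algebraic point (ℝ_alg ≺ ℝ;
PROVED cone: Literature.ModelTheory.ExponentialFields.tarski_seidenberg_real_holds,
definable_iff_isSemialgebraic_real_holds, real_isOMinimal_holds, tarski_isComplete_holds); (iii)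
real-algebraic coefficients are ℚ-definable. "Coefficients in ℚ̄" (KontsevichZagier2001 §1.2
Conjecture 1) thereby leaves the statement by elementary equivalence, and real-analytic / o-minimal
existence arguments (definable choice, curve selection, generic or limiting parameters) become
admissible tools for intermediate data.

How X is typed TODAY: `Literature.NumberTheory.Transcendental.KZ.IntegralRep` pins `IsSemialgebraic
ℚ`, so the real-coefficient calculus is written INLINE as a `let`-prefix over existing declarations
— raw pairs (σ ⊆ ℝⁿ, f), admissibility Adm (ℝ-semialgebraic domain, ℝ-semialgebraic integrand on it,
IntegrableOn) imposed inside each of the four move sets copied from KZCalculus with ℝ in place of ℚ,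
Rel = the subgroup they generate, incl : KZ.FormalRep →+ (raw free group) forgetting the
ℚ-structure. The same prefix opens Transfer; both are stop-gaps to be superseded by V2 statements
over the posited definition `KZ.Coeff k` (definition request filed; precedent KZExpCalculus.lean).
All nine items elaborate (planner Sketch.lean, lean check rc 0) and the Assembly term `fun _ hT hR _
_ r r' hr hr' hv => hT _ (hR r r' hr hr' hv)` typechecks.
Lean: `let Adm : (Σ n : ℕ, Set (Fin n → ℝ) × ((Fin n → ℝ) → ℝ)) → Prop := fun x =>
Literature.ModelTheory.ExponentialFields.IsSemialgebraic ℝ x.2.1 ∧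
Literature.NumberTheory.Transcendental.IsSemialgebraicFunOn ℝ x.2.1 x.2.2 ∧
MeasureTheory.IntegrableOn x.2.2 x.2.1; let o : (Σ n : ℕ, Set (Fin n → ℝ) × ((Fin n → ℝ) → ℝ)) →
FreeAbelianGroup (Σ n : ℕ, Set (Fin n → ℝ) × ((Fin n → ℝ) → ℝ)) := FreeAbelianGroup.of; let Rel :
AddSubgroup (FreeAbelianGroup (Σ n : ℕ, Set (Fin n → ℝ) × ((Fin n → ℝ) → ℝ))) := AddSubgroup.closure
({c | ∃ (n : ℕ) (σ σ₁ σ₂ : Set (Fin n → ℝ)) (f f₁ f₂ : (Fin n → ℝ) → ℝ), Adm ⟨n, σ, f⟩ ∧ Adm ⟨n, σ₁,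
f₁⟩ ∧ Adm ⟨n, σ₂, f₂⟩ ∧ σ = σ₁ ∪ σ₂ ∧ MeasureTheory.volume (σ₁ ∩ σ₂) = 0 ∧ Set.EqOn f f₁ σ₁ ∧
Set.EqOn f f₂ σ₂ ∧ c = o ⟨n, σ, f⟩ - o ⟨n, σ₁, f₁⟩ - o ⟨n, σ₂, f₂⟩} ∪ {c | ∃ (n : ℕ) (σ : Set (Fin n
→ ℝ)) (f f₁ f₂ : (Fin n → ℝ) → ℝ), Adm ⟨n, σ, f⟩ ∧ Adm ⟨n, σ, f₁⟩ ∧ Adm ⟨n, σ, f₂⟩ ∧ Set.EqOn f (f₁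
+ f₂) σ ∧ c = o ⟨n, σ, f⟩ - o ⟨n, σ, f₁⟩ - o ⟨n, σ, f₂⟩} ∪ {c | ∃ (n : ℕ) (σ σ' : Set (Fin n → ℝ))
(f f' : (Fin n → ℝ) → ℝ) (Φ : (Fin n → ℝ) → (Fin n → ℝ)) (Φ' : (Fin n → ℝ) → (Fin n → ℝ) →L[ℝ] (Fin
n → ℝ)), Adm ⟨n, σ, f⟩ ∧ Adm ⟨n, σ', f'⟩ ∧
Literature.NumberTheory.Transcendental.IsSemialgebraicMapOn ℝ σ Φ ∧ (∀ x ∈ σ, HasFDerivWithinAt Φ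
(Φ' x) σ x) ∧ Set.InjOn Φ σ ∧ σ' = Φ '' σ ∧ (∀ x ∈ σ, f x = f' (Φ x) * |(Φ' x).det|) ∧ c = o ⟨n, σ,
f⟩ - o ⟨n, σ', f'⟩} ∪ {c | ∃ (n : ℕ) (β : Set (Fin (n + 1) → ℝ)) (g : (Fin (n + 1) → ℝ) → ℝ) (τ :
Set (Fin n → ℝ)) (h : (Fin n → ℝ) → ℝ) (a b : (Fin n → ℝ) → ℝ) (F : (Fin (n + 1) → ℝ) → ℝ), Adm ⟨n +
1, β, g⟩ ∧ Adm ⟨n, τ, h⟩ ∧ Literature.NumberTheory.Transcendental.IsSemialgebraicFunOn ℝ β F ∧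
Literature.NumberTheory.Transcendental.IsSemialgebraicFunOn ℝ τ a ∧
Literature.NumberTheory.Transcendental.IsSemialgebraicFunOn ℝ τ b ∧ (∀ x ∈ τ, a x ≤ b x) ∧ β = {z |
(Fin.init z : Fin n → ℝ) ∈ τ ∧ a (Fin.init z) ≤ z (Fin.last n) ∧ z (Fin.last n) ≤ b (Fin.init z)} ∧
(∀ x ∈ τ, ContinuousOn (fun t : ℝ => F (Fin.snoc x t)) (Set.Icc (a x) (b x))) ∧ (∀ x ∈ τ, ∀ t ∈
Set.Ioo (a x) (b x), HasDerivAt (fun s : ℝ => F (Fin.snoc x s)) (g (Fin.snoc x t)) t) ∧ (∀ x ∈ τ, h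
x = F (Fin.snoc x (b x)) - F (Fin.snoc x (a x))) ∧ c = o ⟨n + 1, β, g⟩ - o ⟨n, τ, h⟩}); let incl :
Literature.NumberTheory.Transcendental.KZ.FormalRep →+ FreeAbelianGroup (Σ n : ℕ, Set (Fin n → ℝ) ×
((Fin n → ℝ) → ℝ)) := FreeAbelianGroup.map (fun x => ⟨x.1, (x.2.domain, x.2.integrand)⟩); ∀ ⦃n m :
ℕ⦄ (r : Literature.NumberTheory.Transcendental.KZ.IntegralRep n) (r' :
Literature.NumberTheory.Transcendental.KZ.IntegralRep m), r.IsRational → r'.IsRational → r.value =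
r'.value → incl (Literature.NumberTheory.Transcendental.KZ.of r -
Literature.NumberTheory.Transcendental.KZ.of r') ∈ Rel`
Target reached (rev 2, operator route-choice (a)): RealKZ ⇐ RealVolumeConjecture — crux #5, the REAL
VOLUME FORM 'volume is the only KZ_ℝ-invariant of compact top-dimensional ℚ-semialgebraic sets'
(Cresson–Viu-Sos's reformulation of Conjecture 1 with real intermediate data), typed over the LANDED
definition `Literature.NumberTheory.Transcendental.KZOver` (KZCalculusOver.lean) as
`KZOver.Equivalent (ofKZOver ℝ K) (ofKZOver ℝ K')` — by the support glue RealKZOfVolumes :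
RealVolumeConjecture → RealKZ (Viu-Sos's semi-canonical reduction and the Cresson–Viu-Sos argument,
both proved in tree, base-changed to KZ_ℝ; proof checked sorry-free in the planner folder). The
inline `let` calculus above is DEFINITIONALLY `KZOver.Raw.Rel` (Iff.rfl) and `incl = KZOver.toRaw ∘
KZOver.baseChange ℚ ℝ ∘ KZOver.equivKZ` on generators, so RealKZ ↔ ∀ ℚ-rational r, r' of equal
value, KZOver.Equivalent (ofKZOver ℝ r) (ofKZOver ℝ r').
Assembly: IntegrabilityLocus → Transfer → RealKZ → KontsevichZagierPeriods (pure logic: RealKZ puts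
incl ([r] − [r']) into Rel, Transfer pulls it back into KZ.relations).
By-product crux NOT in the Assembly: DescribedEquivalenceRE — the set of pairs of ordered-ring codes
(tree DecidableTheory Gödel numbering) describing KZ-equivalent representations is r.e., discharging
hypothesis `hre` of Literature.Barriers.KontsevichZagierPeriods.KZ.decidable_value_eq_of_complete
("Conjecture 1 ⇒ Problem 1" then keeps only effective Yoshinaga, `hcomp`, as hypothesis).

Rationale: WHY THIS LINE. Imported area: model theory of real closed fields / o-minimal geometry (Tarski
transfer, definability of integrability loci, bi-Lipschitz triviality), aimed not at the VALUES of
periods (Yoshinaga2008, CommelinHabeggerHuber2020, card unlikely-intersections) but at the PROOF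
RELATION of the calculus: for a fixed chain template, "r_d ~ r'_d by this template with real data d"
is a ℚ-definable condition on d. Three consequences need neither motives nor transcendence: Transfer
(real, a fortiori algebraic, coefficients of intermediates are free), ind-ℚ-semialgebraicity of
bounded equivalence E_N in families (BoundedChainLocus), and r.e.-ness of KZ.Equivalent /
decidability of bounded equivalence (DescribedEquivalenceRE) — the last turns the tree's conditional
barrier not_complete_of_undecidable into a kill switch. The cone is PROVED in tree
(TarskiSeidenbergRealClosed, RealClosedFieldTheoryProofs, RealClosedTransfer, RCFDecidabilityProofs,
SemialgebraicInterior, DecidableTheory) except ONE printed fact, made crux #2. Sources: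
KontsevichZagier2001 §1.1–1.2; ComteLionRolin2000 Thm 1′ / Prop. 1 (read, pp. 885–886: locus of
finite fibre volume = union of Parusiński strata, Parusinski1994 Thm 1.6 / Lemma 1.7); Valette2005
(semialgebraic bi-Lipschitz Hardt); Kaiser2005 (read, Thm p. 175: one variable, o-minimal);
Kaiser2013; CluckersMiller2011, CluckersMiller2012IMRN; Tarski1951, BasuPollackRoy2006 §2.5.1;
CressonViusos2022 §1 p. 2 (coefficient field named as obstruction, no transfer); tree
PeriodEqualityDecidability (REEq, hre as hypotheses). Rev 2 (route-choice (a), 2026-08-16): the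
target RealKZ is now REACHED inside the route through the real-coefficient VOLUME FORM (crux #5
RealVolumeConjecture, Cresson–Viu-Sos's reformulation of Conjecture 1 — CressonViusos2022 §1 p. 326
— with real intermediate data, typed over the landed definition KZOver of KZCalculusOver.lean) and
the support glue RealKZOfVolumes : RealVolumeConjecture → RealKZ, whose proof (Viu-Sos's
semi-canonical reduction, PROVED in tree as KZ.semiCanonicalReduction_holds, and the tree's
kzPeriodConjecture'_of_volumeConjectureCompact argument, base-changed to KZ_ℝ) is checked sorry-free
in the planner folder.
RANKED CRUXES. #2 IntegrabilityLocus — the L¹-locus of a ℚ-semialgebraic family is ℚ-semialgebraic;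
first because it is the unvendored printed input (the route is not staffed beyond it until it
lands); plan: subgraph trick (tree volume_subgraph_eq) → finiteness of fibre VOLUME → CLR inversion
+ semialgebraic bi-Lipschitz triviality (Valette2005 over ℝ, to vendor as a named fact; cite request
filed) → trivialisation made ℚ-definable by this route's own AlgebraicPoints / AlgebraicCoefficients
→ locus = union of ℚ-strata (why it might fail: the PARAMETER claim ℚ-vs-ℝ is unprinted; a
non-definable vector-field triviality would not transfer; sources ComteLionRolin2000, Valette2005,
Kaiser2013). #3 Transfer — Rel.comap incl = KZ.relations for the inline real-coefficient calculus
(why it might fail: only via a side condition not first-order over ℚ in the data — integrability,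
#2, is the single candidate; null overlap = empty interior, NullIffEmptyInterior; sources
Tarski1951, BasuPollackRoy2006, KontsevichZagier2001). #4 DescribedEquivalenceRE [NOT in the
Assembly] — pairs of ordered-ring codes describing KZ-equivalent representations form an r.e. set;
verification of coded derivations = Tarski sentences (tree tarski_isDecidable_holds) + an EFFECTIVE
#2 (why it might fail: definable ≠ computable, no printed algorithm for ∫_σ|p/q| < ∞, cf.
Yoshinaga2008 Lemma 29; sources KontsevichZagier2001 Problem 1, KenisonEtAl2021,
SertozOuaknineWorrell2025). #5 RealVolumeConjecture — REAL VOLUME FORM: two compact top-dimensional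
ℚ-semialgebraic bodies K, K′ ⊂ ℝ^d of equal volume (integrand 1) are KZ_ℝ-equivalent, i.e. joined by
finitely many real-semialgebraic scissors cuts, Jacobian-twisted real-semialgebraic changes of
variables and Newton–Leibniz moves with real data (KZOver.Equivalent (ofKZOver ℝ K) (ofKZOver ℝ
K′)); sandwiched: tree KZ.volumeConjectureCompact ⇒ #5 (base change, one line, checked) and #5 + #3
⇒ volumeConjectureCompact ⇒ summit (tree kzPeriodConjecture'_of_volumeConjectureCompact +
semiCanonicalReduction_holds); it is the normal form in which the route's real tools act on the
simplest objects — no integrability side condition at the endpoints, isovolumetric cuts at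
transcendental heights and real volume-preserving semialgebraic maps admissible (why it might fail:
summit-strength; a Dehn-type invariant of real-semialgebraic volume-preserving cut-and-paste +
Fubini moves on ℚ-definable compact bodies finer than volume kills it and the summit; Blass–Schanuel
call the ℝ-classification intractable, CressonViusos2022 §2.2 Rem (3); sources CressonViusos2022 §1
p. 326 Conjecture and Conj. 1.1, ViuSos2021 Thm 1.1, KontsevichZagier2001 §1.2,
BochnakCosteRoy1998).
TARGET #0 RealKZ (conjecture strength; = summit given #3) — REACHED from #5 by the support glue
RealKZOfVolumes (rev 2). ASSEMBLY #1: #2 → #3 → #0 → summit (pure logic, term checked in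
Sketch.lean; the deciding theorem `closes` is unchanged).
SUPPORT. RealKZOfVolumes (rev 2, GLUE reaching the target: RealVolumeConjecture → RealKZ; provable
now — proof checked rc 0 / 0 sorries in the planner folder GlueProof.lean: RealKZ ↔ ∀ ℚ-rational r,
r′ of equal value, KZOver.Equivalent (ofKZOver ℝ r) (ofKZOver ℝ r′), because the inline `let` Rel of
RealKZ is DEFINITIONALLY KZOver.Raw.Rel (Iff.rfl) and incl = toRaw ∘ baseChange ℚ ℝ ∘ equivKZ on
generators (rfl); then the Cresson–Viu-Sos reduction base-changed by
KZOver.baseChange_mem_relations). Typed, provable now, reusable by cards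
real-coefficient-period-germs and chains-have-standard-parts: AlgebraicPoints (ℝ_alg ≺ ℝ, ∃-case),
AlgebraicCoefficients (ℝ_alg-semialgebraic ⇒ ℚ-semialgebraic), NullIffEmptyInterior, CovTransfer
(calibration of #3 inside KZCalculus; needs no #2). Informal (filed after open): BoundedChainLocus
(E_N ℚ-semialgebraic in KZ.Coeff-families; corollaries: Transfer = E_N at a point + AlgebraicPoints;
a coefficient point on no positive-dimensional semialgebraic arc of {v = v'} at which r_c ~_ℝ r'_c
must be ALGEBRAIC — chain complexity jumps at special fibres; unconditional non-equivalence over ℝ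
at transcendental isolated coincidences, e.g. unit disc vs (0,π)×(0,1)).
TWO-LAYER PLAN. RealKZ ⇐ RealVolumeConjecture (glue RealKZOfVolumes, k = 1, proof in hand). Foreseen
split of #5 (only after #3 or a sector of #5 closes): RealStableTransport (after × [0,1]^M, ONE real
Jacobian-1 semialgebraic bijection modulo null sets — the ℝ-coefficient analogue, restricted to
ℚ-definable endpoints, of ScissorsTransport.StableSetTransport; CircleSquaringImpossible is its
failure for the non-ℚ-definable pair disc / (0,π)×(0,1)) → RealVolumeConjecture, or a
bounded-intermediates form of #5 that makes #2 unnecessary for volumes. Transfer ⇐ BoundedChainLocus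
→ AlgebraicPoints → AlgebraicCoefficients → Transfer (k = 3) once KZ.Coeff lands; IntegrabilityLocus
⇐ (Valette bi-Lipschitz Hardt fact) → (ℚ-definable trivialisation) → IntegrabilityLocus;
DescribedEquivalenceRE ⇐ (effective L¹-test) → (coded-derivation checker) → DescribedEquivalenceRE.
KILL CRITERIA. (a) A ℚ-semialgebraic family whose L¹-locus is not ℚ-semialgebraic refutes #2 (and #3
if that locus is where the chain data live and has no algebraic point): close `refuted`, record
"integrability is the non-elementary part of the calculus" for route Neg. (b) An ℝ-chain between
ℚ-representations with provably no ℚ-chain refutes #3, CovTransfer and the card. (c) A proof that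
∫_σ|p/q| < ∞ is not Σ₁ kills #4 only. (d) RealKZ dies only with the summit (strength barriers apply
to it unchanged). (e) An invariant of KZ_ℝ-equivalence of compact ℚ-semialgebraic bodies finer than
volume refutes #5 and, by base change (tree volumeConjectureCompact_of_kzPeriodConjecture',
KZOver.Equivalent.ofKZOver), the summit: close `refuted`; the field-of-definition invariants of
CircleSquaringImpossible / RealPeriodGerms.NotNaiveRealKZ separate only NON-ℚ-definable pairs and do
not count.
NOT DECOMPOSED YET. The definition request KZ.Coeff k is FULFILLED (KZOver,
Literature/NumberTheory/Transcendental/KZCalculusOver.lean, with the raw comparison lemmas): #5 is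
typed over it; V2 restatements of RealKZ / Transfer over KZOver (RealKZ's inline Rel =
KZOver.Raw.Rel definitionally) and #3's split are left to tenure. #5 is deliberately NOT decomposed:
every generic/special, arc or limit split of RealKZ examined is degenerate (linearity and scaling
put every coincidence of values on a trivial value-preserving ℚ-arc, so 'arc propagation' restates
RealKZ; closure of bounded-template loci under limits is equivalent to the conjecture by Archimedean
exhaustion; attaching RealPeriodGerms.GermComplete would duplicate that route), so the target is
reached through the one NORMAL FORM whose reduction is a theorem of the tree. The card's (S)-gluing
(arcs vs isolated points of E_N inside the coincidence locus) is recorded in BoundedChainLocus, not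
filed as an assembly: naive arc/rigid case splits are degenerate (every coincidence lies on trivial
value-preserving arcs) and the engines belong to other cards
(parameter-as-variable-transport-of-constants, gauss-manin-rational-certificates,
riemann-bilinear-unnesting-triplication-isogeny, correspondences-as-multivalued-cov). Effective
Yoshinaga (UniformlyComputable of values on codes) is not filed here (tree
SemialgebraicVolumeComputable programme). Catalogue used: model-theoretic transfer + decidable side
conditions; no spectral, probabilistic or physical analogy applies. Prior-programme inspiration: not
read (plancard mode).
CHEAPEST FALSIFIER. For #2 the planner computed by hand the L¹-loci of ∫_0^1 dx/(x²+c) ({c > 0} ∪ {c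
< −1}), ∫∫_{[0,1]²} dxdy/(x²+y²−c) ({c < 0} ∪ {c ≥ 2}) and ∫_{max(c,0)}^1 dx/x ({c > 0}): all
thresholds algebraic, consistent. A refuter should try to force a TRANSCENDENTAL integrability
threshold in a ℚ-family (cancellation orders, f = (h₁ − h₂)/k, or colliding singular strata) — one
example kills #2 and #3 together; for #3 alone, an ℝ-CoV/ℝ-primitive between ℚ-reps that no ℚ-data
replaces (CovTransfer is the typed arena); for #4, integrability not Σ₁; for #5, the smallest honest
instance — unit disc vs {0 < x < 1, 0 < y < 4/(1+x²)}, both of area π — HAS a ℚ-chain (hand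
computation: shear to the subgraph of 2√(1−x²), split 2√(1−x²) = (x√(1−x²))′ + 1/√(1−x²), kill the
exact term by Newton–Leibniz, Weierstrass substitution x = 2t/(1+t²), Newton–Leibniz back up), so a
refuter should test candidate invariants of real equidecomposability on equal-volume compact ℚ-pairs
whose known chains need transcendental primitives one dimension up (ζ(2)-, ζ(3)- or elliptic-volume
bodies against rational recombinations of simpler ones).
DEFINITION REQUESTS. (1) [FULFILLED by KZOver / KZCalculusOver.lean] KZ.Coeff k — KZCalculus
verbatim over a coefficient ring k with Algebra k ℝ (k = ℚ, integralClosure ℚ ℝ, ℝ), incl,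
map_relations_le, soundness; precedent KZExpCalculus.lean. (2) cite/fact: Valette2005 bi-Lipschitz
semialgebraic triviality (Hardt) as a named Literature fact. (Codes for #4 need nothing new: tree
DecidableTheory Encodable instances.)

Novelty: NEAREST PRIOR ART (searched this session: lit --hybrid "locus of integrability semialgebraic family"
(no held text); zbMATH "loci of integrability constructible functions" → CluckersMiller2012IMRN
(doi:10.1093/imrn/rnr133), "Kaiser integration semialgebraic functions integrated Nash" → Kaiser2013
(doi:10.1007/s00209-012-1138-1), "Lipschitz triangulations" → Valette2005; crossref → Kaiser2017
(doi:10.1112/plms.12070), ComteLionRolin2000 READ pp. 884–886 (Thm 1′, Prop. 1), Kaiser2005 READ pp.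
175–177 (Thm); lit galaxy "integration of semialgebraic functions" / "loci of integrability" /
"nature log-analytique" --star all (0 relevant) and --mode intelligent pdf (0 relevant); lit
frontier / bridges KontsevichZagierPeriods (MZV and transcendence descendants only); the card's
audit: Yoshinaga2008 Thm 25/Lemma 26 and CommelinHabeggerHuber2020 = tameness/elimination for
VALUES; CressonViusos2022 §1 p. 2 = coefficient restriction named as an obstruction, no transfer;
tree PeriodEqualityDecidability = r.e.-ness of the move relation kept as HYPOTHESIS REEq / hre;
Poonen2014 §8.1.1). In print: definability of finite-volume / integrability loci (ComteLionRolin2000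
Prop. 1, Kaiser2005, Kaiser2013, CluckersMiller2011, CluckersMiller2012IMRN), semialgebraic
bi-Lipschitz triviality (Parusinski1994, Valette2005, HalupczokYin2018) and Tarski transfer
(Tarski1951, BasuPollackRoy2006 Thm 2.80) — the INPUTS. Not found in print or in tree: (1) the move
relation of KZ's calculus is ind-ℚ-semialgebrai  [refs: 10.1093/imrn/rnr133, 10.1007/s00209-012-1138-1, 10.1112/plms.12070, doi:10.1093/imrn/rnr133, doi:10.1007/s00209-012-1138-1, doi:10.1112/plms.12070, Kaiser2013, Valette2005, Kaiser2017, ComteLionRolin2000, Kaiser2005, Yoshinaga2008, CommelinHabeggerHuber2020, CressonViusos2022, Poonen2014, CluckersMiller2011, Parusinski1994, HalupczokYin2018, Tarski1951, BasuPollackRoy2006]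

Barriers (technique_class: tarski-transfer, decidable-side-conditions): - technique_class: tarski-transfer, o-minimal-definability, decidable-side-conditions,
integrability-loci
- Literature.Barriers.KontsevichZagierPeriods.not_complete_of_undecidable: engaged on purpose, not
evaded — the barrier is conditional (no undecidability theorem for period equality exists;
KenisonEtAl2021 App. A.2, SertozOuaknineWorrell2025 (1.0.1)); crux #4 DescribedEquivalenceRE
discharges its r.e. hypothesis `hre` for the canonical ordered-ring coding, so afterwards an
undecidability theorem for equality of uniformly computable periods would refute the summit THROUGH
this route (kill switch); cruxes #2, #3 and the target enumerate nothing and are outside its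
technique class.
- Literature.Barriers.KontsevichZagierPeriods.noSemialgebraicPrimitive_inv_sub_two: not in class
(primitive-elimination / fixed-number-of-variables) — no primitive is constructed and no bound on
variables is imposed; Transfer replaces real by algebraic COEFFICIENTS inside a given chain, never a
transcendental primitive by a semialgebraic one (a chain using F = log is not an ℝ-semialgebraic
chain either).
- Literature.Barriers.KontsevichZagierPeriods.cressonViuSos_prop_3_2: not in class (one global map
without dissection) — chains keep all four moves including scissors; CovTransfer concerns a single
CoV instance but claims nothing about sufficiency of single maps; SemialgebraicHauptvermutung
untouched.
- Literature.Barriers.KontsevichZagierPeriods.kzConjecture_implies_oddZetaAlgIndep: strength barr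

History (route lifecycle, newest last):
- 2026-08-16T02:18:01Z · AUTO-CRUX: 2 conjecture-grade item(s) promoted to crux (RealKZ, TemplateComplexityUnbounded) — refuter vetting / tiering apply (operator:999:1362873)
- 2026-08-16T04:08:05Z · AUTO-CRUX (backfill): RealKZ — hypotheses of the deciding theorem that nothing in the route derives are cruxes (operator:999:1085951)
- 2026-08-17T02:15:21Z · rev 3: dropped stmt-KontsevichZagierPeriods-0541 — strategist: remove the decl-less attach of 0541 made by workitem add (rank 7, no decl_name); re-attached in the same session via add_items WITH decl_name AyoubP (planner-cstrat-stmt-KontsevichZagierPeriods-4085-r1-0)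
- 2026-08-23T19:11:05Z · DORMANT — reconciler: no traction for 6.2 d (last activity item-evidence-added at 2026-08-17T14:24:36Z); parked, not closed — `ledger route dormant route-KontsevichZagier (operator:999:1073745)
- 2026-08-30T04:22:27Z · REACTIVATED — reconciler: reactivated — activity item-evidence-added at 2026-08-30T03:11:14Z after parking at 2026-08-23T19:11:05Z (operator:999:1951256)
- 2026-09-04T05:10:19Z · DORMANT — reconciler: no traction for 5 d (last activity statement-checked at 2026-08-30T04:31:34Z); parked, not closed — `ledger route dormant route-KontsevichZagierPeri (operator:999:3195046)

sub-problem: KontsevichZagierPeriods · status: dormant · opened planner-plancard-KontsevichZagierPeriods-Kont-7645a11f-0 2026-08-15T11:27:36Z · rev 4 · ledger route-KontsevichZagierPeriods-DefinableMoves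
GENERATED by the gate from the ledger (D-0016/17). Provers cite these decls: `theorem foo : Summit.KontsevichZagierPeriods.KontsevichZagierPeriods.Theses.DefinableMoves.<Decl> := …` in Summits/KontsevichZagierPeriods/KontsevichZagierPeriods/Theorems/<Name>.lean.
-/

namespace Summit.KontsevichZagierPeriods.KontsevichZagierPeriods.Theses.DefinableMoves

open scoped BigOperators Topology Manifold Classical MeasureTheory ProbabilityTheory Matrix InnerProductSpace ComplexConjugate ContinuousMap
open Filter Set Function TopologicalSpace MeasureTheory

attribute [summit_statement] _root_.KontsevichZagierPeriods

open Literature Periods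

/-- item stmt-KontsevichZagierPeriods-4085 · crux (kind.auto-crux: conjecture-grade) · rank 0 · open · by planner
why it might fail: Conjecture strength: fails iff the summit fails (given Transfer); the strength barriers kzConjecture_implies_* apply to it unchanged.
sources: KontsevichZagier2001, CressonViusos2022
[target] X = Conjecture 1 with REAL intermediates: for ℚ-rational r, r' with equal value, incl([r] −
[r']) lies in the subgroup Rel of the free abelian group on raw pairs (σ ⊆ ℝⁿ, f) generated by the
four KZ move sets rewritten with ℝ-semialgebraic data — admissibility Adm (ℝ-semialgebraic domain,
ℝ-semialgebraic integrand on it, IntegrableOn) imposed on every representation occurring in a move,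
auxiliary Φ, F, a, b ℝ-semialgebraic — incl forgetting the ℚ-structure. The `let`-prefix IS the
posited calculus KZ.Coeff ℝ written inline (stop-gap; to be superseded by a V2 over the definition
once it lands — definition request filed). Formally WEAKER than the summit (each ℚ-move is an ℝ-move
by base change, tree isSemialgebraic_algebra_of_isSemialgebraic), equivalent to it by Transfer; it
is the form in which o-minimal existence arguments for intermediate data (definable choice, curve
selection, generic or limit parameters) are admissible, and the K = ℚ fibre of card
real-coefficient-period-germs' corrected ℝ-conjecture. NOT the naive conjecture for ℝ-endpoints,
which is false (unit disc vs (0,π)×(0,1), ibid. D2). Soundness (Rel ≤ ker of (σ,f) ↦ ∫_σ f) holds by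
the proofs of KZ.relations -/
@[route_item "route-KontsevichZagierPeriods-DefinableMoves"]
def RealKZ : Prop :=
  let Adm : (Σ n : ℕ, Set (Fin n → ℝ) × ((Fin n → ℝ) → ℝ)) → Prop := fun x => Literature.ModelTheory.ExponentialFields.IsSemialgebraic ℝ x.2.1 ∧ Literature.NumberTheory.Transcendental.IsSemialgebraicFunOn ℝ x.2.1 x.2.2 ∧ MeasureTheory.IntegrableOn x.2.2 x.2.1; let o : (Σ n : ℕ, Set (Fin n → ℝ) × ((Fin n → ℝ) → ℝ)) → FreeAbelianGroup (Σ n : ℕ, Set (Fin n → ℝ) × ((Fin n → ℝ) → ℝ)) := FreeAbelianGroup.of; let Rel : AddSubgroup (FreeAbelianGroup (Σ n : ℕ, Set (Fin n → ℝ) × ((Fin n → ℝ) → ℝ))) := AddSubgroup.closure ({c | ∃ (n : ℕ) (σ σ₁ σ₂ : Set (Fin n → ℝ)) (f f₁ f₂ : (Fin n → ℝ) → ℝ), Adm ⟨n, σ, f⟩ ∧ Adm ⟨n, σ₁, f₁⟩ ∧ Adm ⟨n, σ₂, f₂⟩ ∧ σ = σ₁ ∪ σ₂ ∧ MeasureTheory.volume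 (σ₁ ∩ σ₂) = 0 ∧ Set.EqOn f f₁ σ₁ ∧ Set.EqOn f f₂ σ₂ ∧ c = o ⟨n, σ, f⟩ - o ⟨n, σ₁, f₁⟩ - o ⟨n, σ₂, f₂⟩} ∪ {c | ∃ (n : ℕ) (σ : Set (Fin n → ℝ)) (f f₁ f₂ : (Fin n → ℝ) → ℝ), Adm ⟨n, σ, f⟩ ∧ Adm ⟨n, σ, f₁⟩ ∧ Adm ⟨n, σ, f₂⟩ ∧ Set.EqOn f (f₁ + f₂) σ ∧ c = o ⟨n, σ, f⟩ - o ⟨n, σ, f₁⟩ - o ⟨n, σ, f₂⟩} ∪ {c | ∃ (n : ℕ) (σ σ' : Set (Fin n → ℝ)) (f f' : (Fin n → ℝ) → ℝ) (Φ : (Fin n → ℝ) → (Fin n → ℝ)) (Φ' : (Fin n → ℝ) → (Fin n → ℝ) →L[ℝ] (Fin n → ℝ)), Adm ⟨n, σ, f⟩ ∧ Adm ⟨n, σ', f'⟩ ∧ Literature.NumberTheory.Transcendental.IsSemialgebraicMapOn ℝ σ Φ ∧ (∀ x ∈ σ, HasFDerivWithinAt Φ (Φ' x) σ x) ∧ Set.InjOn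 Φ σ ∧ σ' = Φ '' σ ∧ (∀ x ∈ σ, f x = f' (Φ x) * |(Φ' x).det|) ∧ c = o ⟨n, σ, f⟩ - o ⟨n, σ', f'⟩} ∪ {c | ∃ (n : ℕ) (β : Set (Fin (n + 1) → ℝ)) (g : (Fin (n + 1) → ℝ) → ℝ) (τ : Set (Fin n → ℝ)) (h : (Fin n → ℝ) → ℝ) (a b : (Fin n → ℝ) → ℝ) (F : (Fin (n + 1) → ℝ) → ℝ), Adm ⟨n + 1, β, g⟩ ∧ Adm ⟨n, τ, h⟩ ∧ Literature.NumberTheory.Transcendental.IsSemialgebraicFunOn ℝ β F ∧ Literature.NumberTheory.Transcendental.IsSemialgebraicFunOn ℝ τ a ∧ Literature.NumberTheory.Transcendental.IsSemialgebraicFunOn ℝ τ b ∧ (∀ x ∈ τ, a x ≤ b x) ∧ β = {z | (Fin.init z : Fin n → ℝ) ∈ τ ∧ a (Fin.init z) ≤ z (Fin.last n) ∧ z (Fin.last n) ≤ b (Fin.init z)} ∧ (∀ x ∈ τ, ContinuousOn (fun t : ℝ => F (Fin.snoc x t)) (Set.Icc (a x) (b x))) ∧ (∀ x ∈ τ, ∀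 t ∈ Set.Ioo (a x) (b x), HasDerivAt (fun s : ℝ => F (Fin.snoc x s)) (g (Fin.snoc x t)) t) ∧ (∀ x ∈ τ, h x = F (Fin.snoc x (b x)) - F (Fin.snoc x (a x))) ∧ c = o ⟨n + 1, β, g⟩ - o ⟨n, τ, h⟩}); let incl : Literature.NumberTheory.Transcendental.KZ.FormalRep →+ FreeAbelianGroup (Σ n : ℕ, Set (Fin n → ℝ) × ((Fin n → ℝ) → ℝ)) := FreeAbelianGroup.map (fun x => ⟨x.1, (x.2.domain, x.2.integrand)⟩); ∀ ⦃n m : ℕ⦄ (r : Literature.NumberTheory.Transcendental.KZ.IntegralRep n) (r' : Literature.NumberTheory.Transcendental.KZ.IntegralRep m), r.IsRational → r'.IsRational → r.value = r'.value → incl (Literature.NumberTheory.Transcendental.KZ.of r - Literature.NumberTheory.Transcendental.KZ.of r') ∈ Rel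

/-- item stmt-KontsevichZagierPeriods-4087 · crux · rank 2 · open · by planner
why it might fail: Only the PARAMETER claim is unprinted (printed loci are ℝ-semialgebraic / globally subanalytic); if the bi-Lipschitz trivialisation cannot be taken definable (vector-field integration à la Parusiński), step (iv) fails and a transcendental threshold could survive.
sources: ComteLionRolin2000, Kaiser2005, Kaiser2013, Valette2005, Parusinski1994, CluckersMiller2012IMRN
[crux] The locus of absolute integrability of a ℚ-semialgebraic family is ℚ-SEMIALGEBRAIC: S ⊆
ℝ^{p+n} and f ℚ-semialgebraic on S ⇒ {c ∈ ℝ^p | f(c,·) ∈ L¹(S_c)} is ℚ-semialgebraic (card item A1;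
the single non-first-order side condition of the calculus). Printed over ℝ / in ℝ_an:
ComteLionRolin2000 Thm 1′ and Prop. 1 (finite-volume locus of a globally subanalytic family is
globally subanalytic; proof pp. 885–886: Parusiński bi-Lipschitz triviality [Parusinski1994 Thm 1.6,
Lemma 1.7] + inversion; locus = union of strata), Kaiser2005 Thm p. 175 (one variable, o-minimal,
archimedean RCF), Kaiser2013 (semialgebraic, integrated Nash functions; paywalled, acq-02163),
CluckersMiller2011 / CluckersMiller2012IMRN (constructible functions; acq-02183). PLAN for the
ℚ-version: (i) ∫_{S_c}|f| < ∞ ⟺ the (n+1)-volume of the subgraph fibre is finite (tree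
KZ.IntegralRep.volume_subgraph_eq, BoundedPeriodComputable) — a ℚ-semialgebraic family of SETS; (ii)
CLR's inversion reduces to relatively compact fibres with volume ratios controlled under
bi-Lipschitz maps fixing 0 (their Affirmation 2, elementary); (iii) semialgebraic bi-Lipschitz
triviality of the family over a finite semialgebraic partition -/
@[route_item "route-KontsevichZagierPeriods-DefinableMoves"]
def IntegrabilityLocus : Prop :=
  ∀ {p n : ℕ} (S : Set (Fin (p + n) → ℝ)) (f : (Fin (p + n) → ℝ) → ℝ), Literature.ModelTheory.ExponentialFields.IsSemialgebraic ℚ S → Literature.NumberTheory.Transcendental.IsSemialgebraicFunOn ℚ S f → Literature.ModelTheory.ExponentialFields.IsSemialgebraic ℚ {c : Fin p → ℝ | MeasureTheory.IntegrableOn (fun y : Fin n → ℝ => f (Fin.append c y)) {y : Fin n → ℝ | Fin.append c y ∈ S}}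

/-- item stmt-KontsevichZagierPeriods-4088 · crux · rank 3 · open · by planner
why it might fail: Fails only through a move side condition not ℚ-definable in the real data: IntegrableOn (crux #2) is the single candidate; if L¹-loci are merely ℝ-semialgebraic, T may have no algebraic point (e.g. T = {π}).
sources: Tarski1951, BasuPollackRoy2006, KontsevichZagier2001, CressonViusos2022
[crux] TRANSFER — real (a fortiori algebraic) coefficients are free for intermediates: with Adm /
Rel / incl as in RealKZ (inline KZ.Coeff ℝ), ∀ c : KZ.FormalRep, incl c ∈ Rel → c ∈ KZ.relations
(i.e. Rel.comap incl = KZ.relations; ≥ is base change). Proof plan: (0) normalise integrands off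
their domains (f ↦ 1_σ·f costs two integrandAdd moves in either calculus; the normalisation
endomorphism maps each move set into itself), so all data are globally semialgebraic; (1) a
derivation of incl c is a finite template (which moves, ℤ-coefficients, shapes/degrees of all
polynomial data) evaluated at a real coefficient vector d₀ ∈ ℝ^q; (2) the set T ⊆ ℝ^q of d at which
the template is a valid derivation of incl c is ℚ-definable in (ℝ,+,·,≤): set identities, EqOn,
InjOn, image, ContinuousOn on closed fibres, HasDerivAt / HasFDerivWithinAt (ε-δ with an
existentially quantified matrix), a ≤ b, band shape and 'equals the endpoint generator' are
first-order; volume(σ₁ ∩ σ₂) = 0 is interior = ∅ (NullIffEmptyInterior; tree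
isSemialgebraic_interior); IntegrableOn of every intermediate is ℚ-semialgebraic in d by
IntegrabilityLocus; hence T is ℚ-semialgebraic (tree definable_iff_isSemialgebraic_real -/
@[route_item "route-KontsevichZagierPeriods-DefinableMoves"]
def Transfer : Prop :=
  let Adm : (Σ n : ℕ, Set (Fin n → ℝ) × ((Fin n → ℝ) → ℝ)) → Prop := fun x => Literature.ModelTheory.ExponentialFields.IsSemialgebraic ℝ x.2.1 ∧ Literature.NumberTheory.Transcendental.IsSemialgebraicFunOn ℝ x.2.1 x.2.2 ∧ MeasureTheory.IntegrableOn x.2.2 x.2.1; let o : (Σ n : ℕ, Set (Fin n → ℝ) × ((Fin n → ℝ) → ℝ)) → FreeAbelianGroup (Σ n : ℕ, Set (Fin n → ℝ) × ((Fin n → ℝ) → ℝ)) := FreeAbelianGroup.of; let Rel : AddSubgroup (FreeAbelianGroup (Σ n : ℕ, Set (Fin n → ℝ) × ((Fin n → ℝ) → ℝ))) := AddSubgroup.closure ({c | ∃ (n : ℕ) (σ σ₁ σ₂ : Set (Fin n → ℝ)) (f f₁ f₂ : (Fin n → ℝ) → ℝ), Adm ⟨n, σ, f⟩ ∧ Adm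 ⟨n, σ₁, f₁⟩ ∧ Adm ⟨n, σ₂, f₂⟩ ∧ σ = σ₁ ∪ σ₂ ∧ MeasureTheory.volume (σ₁ ∩ σ₂) = 0 ∧ Set.EqOn f f₁ σ₁ ∧ Set.EqOn f f₂ σ₂ ∧ c = o ⟨n, σ, f⟩ - o ⟨n, σ₁, f₁⟩ - o ⟨n, σ₂, f₂⟩} ∪ {c | ∃ (n : ℕ) (σ : Set (Fin n → ℝ)) (f f₁ f₂ : (Fin n → ℝ) → ℝ), Adm ⟨n, σ, f⟩ ∧ Adm ⟨n, σ, f₁⟩ ∧ Adm ⟨n, σ, f₂⟩ ∧ Set.EqOn f (f₁ + f₂) σ ∧ c = o ⟨n, σ, f⟩ - o ⟨n, σ, f₁⟩ - o ⟨n, σ, f₂⟩} ∪ {c | ∃ (n : ℕ) (σ σ' : Set (Fin n → ℝ)) (f f' : (Fin n → ℝ) → ℝ) (Φ : (Fin n → ℝ) → (Fin n → ℝ)) (Φ' : (Fin n → ℝ) → (Fin n → ℝ) →L[ℝ] (Fin n → ℝ)), Adm ⟨n, σ, f⟩ ∧ Adm ⟨n, σ', f'⟩ ∧ Literature.NumberTheory.Transcendental.IsSemialgebraicMapOn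 ℝ σ Φ ∧ (∀ x ∈ σ, HasFDerivWithinAt Φ (Φ' x) σ x) ∧ Set.InjOn Φ σ ∧ σ' = Φ '' σ ∧ (∀ x ∈ σ, f x = f' (Φ x) * |(Φ' x).det|) ∧ c = o ⟨n, σ, f⟩ - o ⟨n, σ', f'⟩} ∪ {c | ∃ (n : ℕ) (β : Set (Fin (n + 1) → ℝ)) (g : (Fin (n + 1) → ℝ) → ℝ) (τ : Set (Fin n → ℝ)) (h : (Fin n → ℝ) → ℝ) (a b : (Fin n → ℝ) → ℝ) (F : (Fin (n + 1) → ℝ) → ℝ), Adm ⟨n + 1, β, g⟩ ∧ Adm ⟨n, τ, h⟩ ∧ Literature.NumberTheory.Transcendental.IsSemialgebraicFunOn ℝ β F ∧ Literature.NumberTheory.Transcendental.IsSemialgebraicFunOn ℝ τ a ∧ Literature.NumberTheory.Transcendental.IsSemialgebraicFunOn ℝ τ b ∧ (∀ x ∈ τ, a x ≤ b x) ∧ β = {z | (Fin.init z : Fin n → ℝ) ∈ τ ∧ a (Fin.init z) ≤ z (Fin.last n) ∧ z (Fin.last n) ≤ b (Fin.init z)} ∧ (∀ x ∈ τ, ContinuousOn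 (fun t : ℝ => F (Fin.snoc x t)) (Set.Icc (a x) (b x))) ∧ (∀ x ∈ τ, ∀ t ∈ Set.Ioo (a x) (b x), HasDerivAt (fun s : ℝ => F (Fin.snoc x s)) (g (Fin.snoc x t)) t) ∧ (∀ x ∈ τ, h x = F (Fin.snoc x (b x)) - F (Fin.snoc x (a x))) ∧ c = o ⟨n + 1, β, g⟩ - o ⟨n, τ, h⟩}); let incl : Literature.NumberTheory.Transcendental.KZ.FormalRep →+ FreeAbelianGroup (Σ n : ℕ, Set (Fin n → ℝ) × ((Fin n → ℝ) → ℝ)) := FreeAbelianGroup.map (fun x => ⟨x.1, (x.2.domain, x.2.integrand)⟩); ∀ c : Literature.NumberTheory.Transcendental.KZ.FormalRep, incl c ∈ Rel → c ∈ Literature.NumberTheory.Transcendental.KZ.relations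

/-- item stmt-KontsevichZagierPeriods-4089 · crux · rank 4 · open · by planner
why it might fail: Definable ≠ computable: no printed ALGORITHM decides ∫_σ|p/q| < ∞ (CLR / Kaiser / Valette proofs are not stated effectively; cf. Yoshinaga2008 Lemma 29, L(D) not computed); if integrability is not even Σ₁ the predicate is not r.e. as stated.
sources: KontsevichZagier2001, Yoshinaga2008, KenisonEtAl2021, SertozOuaknineWorrell2025, Poonen2014, Tarski1951
[crux] KZ-EQUIVALENCE IS RECURSIVELY ENUMERABLE on descriptions (card item (D); NOT in the
Assembly): code a representation by a pair of parameter-free formulas of the tree's ordered-ring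
language — P for the domain σ ⊆ ℝⁿ, Q for the graph of the integrand over σ; Gödel numbering = the
tree's computable Encodable instances (DecidableTheory.lean) — and assert that the set of pairs of
codes describing two KZ-equivalent representations is r.e. (REPred on ℕ × ℕ). Every representation
has a code (ℚ-semialgebraic = ℤ-definable without parameters) and codes pin the integrand only on
the domain (all such representations are equivalent by two integrandAdd moves), so this is the
honest r.e.-ness of KZ.Equivalent; it DISCHARGES hypothesis `hre` of
Literature.Barriers.KontsevichZagierPeriods.KZ.decidable_value_eq_of_complete /
not_complete_of_undecidable for the canonical coding: afterwards 'Conjecture 1 ⇒ equality of periods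
decidable' keeps only uniform computability of values (effective Yoshinaga; tree
SemialgebraicVolumeComputable, BoundedPeriodComputable) as hypothesis, and an undecidability theorem
for period equality would refute the summit outright. Proof plan: enumerate (pair of codes -/
@[route_item "route-KontsevichZagierPeriods-DefinableMoves"]
def DescribedEquivalenceRE : Prop :=
  REPred (fun p : ℕ × ℕ => ∃ (n m : ℕ) (P : Literature.ModelTheory.ExponentialFields.Language.orderedRing.Formula (Fin n)) (Q : Literature.ModelTheory.ExponentialFields.Language.orderedRing.Formula (Fin (n + 1))) (P' : Literature.ModelTheory.ExponentialFields.Language.orderedRing.Formula (Fin m)) (Q' : Literature.ModelTheory.ExponentialFields.Language.orderedRing.Formula (Fin (m + 1))) (r : Literature.NumberTheory.Transcendental.KZ.IntegralRep n) (r' : Literature.NumberTheory.Transcendental.KZ.IntegralRep m), Encodable.encode (⟨n, (P, Q)⟩ : Σ k : ℕ, Literature.ModelTheory.ExponentialFields.Language.orderedRing.Formula (Fin k) × Literature.ModelTheory.ExponentialFields.Language.orderedRing.Formula (Fin (k + 1))) = p.1 ∧ Encodable.encode (⟨m, (P', Q')⟩ : Σ k : ℕ, Literature.ModelTheory.ExponentialFields.Language.orderedRing.Formula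 (Fin k) × Literature.ModelTheory.ExponentialFields.Language.orderedRing.Formula (Fin (k + 1))) = p.2 ∧ r.domain = {x | P.Realize x} ∧ {z | Q.Realize z} = {z | (Fin.init z : Fin n → ℝ) ∈ r.domain ∧ z (Fin.last n) = r.integrand (Fin.init z)} ∧ r'.domain = {x | P'.Realize x} ∧ {z | Q'.Realize z} = {z | (Fin.init z : Fin m → ℝ) ∈ r'.domain ∧ z (Fin.last m) = r'.integrand (Fin.init z)} ∧ Literature.NumberTheory.Transcendental.KZ.Equivalent r r')

/-- item stmt-KontsevichZagierPeriods-14461 · crux · rank 5 · open · by planner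
why it might fail: Summit-strength (⇔ Conjecture 1 given Transfer; reduction proved in tree): a Dehn-type invariant of real-semialgebraic volume-preserving cut-and-paste + Fubini moves on ℚ-definable compact bodies, finer than volume, kills it and the summit; Blass–Schanuel call the ℝ-classification intractable.
sources: CressonViusos2022, ViuSos2021, KontsevichZagier2001, BochnakCosteRoy1998, Sydler1965, DubinsHirschKarush1963
[crux] REAL VOLUME FORM — volume is the only KZ_ℝ-invariant of compact top-dimensional
ℚ-semialgebraic sets: for K, K′ ⊂ ℝ^d compact with non-empty interior, ℚ-semialgebraic, integrand 1,
vol K = vol K′, the real base changes are equivalent in the real-coefficient calculus KZ_ℝ = KZOver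
ℝ (Literature/NumberTheory/Transcendental/KZCalculusOver.lean, the landed form of this route's
definition request KZ.Coeff k): finitely many real-semialgebraic scissors cuts, Jacobian-twisted
real-semialgebraic changes of variables and Newton–Leibniz moves with real primitives/bounds join K
to K′. This is Cresson–Viu-Sos's volume form of Conjecture 1 (CressonViusos2022 §1 p. 326
'Conjecture', tree KZ.volumeConjectureCompact; cf. their GKZ Conj. 1.1 and Thm 2.1) with REAL
intermediate data and ℚ-definable endpoints — the arena of the Blass–Schanuel classification
(ℝ-semialgebraic sets up to ℝ-semialgebraic volume-preserving bijections modulo lower-dimensional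
sets, called intractable: CressonViusos2022 §2.2 Rem (3)) restricted to the pairs on which Tarski
transfer (#3) says real freedom costs nothing. Sandwich (both directions one line over tree
theorems): KZ.volumeConjectureCompact → RealVolumeConje -/
@[route_item "route-KontsevichZagierPeriods-DefinableMoves"]
def RealVolumeConjecture : Prop :=
  ∀ ⦃d : ℕ⦄ (K K' : Literature.NumberTheory.Transcendental.KZ.IntegralRep d), IsCompact K.domain → (interior K.domain).Nonempty → IsCompact K'.domain → (interior K'.domain).Nonempty → (∀ x ∈ K.domain, K.integrand x = 1) → (∀ x ∈ K'.domain, K'.integrand x = 1) → K.value = K'.value → Literature.NumberTheory.Transcendental.KZOver.Equivalent (Literature.NumberTheory.Transcendental.KZOver.IntegralRep.ofKZOver ℝ K) (Literature.NumberTheory.Transcendental.KZOver.IntegralRep.ofKZOver ℝ K')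

/-- item stmt-KontsevichZagierPeriods-17880 · crux · rank 6 · open · by planner
why it might fail: A real certificate for [π]⋆c may mix the two disc coordinates with c's (carrier migration), leaving nothing to specialise fibrewise; motivic shadow (P̃(MM^eff_Nori) → P̃(MM_Nori) injective) OPEN in print (HuberWustholz2022 App. A.4); one ℚ-witness c refutes it, 0540 (given Transfer) and the summit.
sources: HuberWustholz2022, AyoubRelKZRevisited, KontsevichZagier2001, HuberMullerStachPeriods2017, CressonViusos2022
[crux] (strategist π-split of RealKZ over ℝ, child 2 of 2) REAL π-CANCELLATION — this route's
real-coefficient form of item stmt-KontsevichZagierPeriods-0540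
(AyoubSpecialisation.AyoubPiCancellation ↔ KZ.PiCancellation): for every formal ℤ-combination c of
KZ representations (ℚ-data), if the real base change of [π] ⋆ c (closed unit disc × c: KZ.piRep and
`*` of KZProduct.lean) lies in the relations of the REAL-coefficient calculus KZ_ℝ = KZOver ℝ
(KZCalculusOver.lean; = RealKZ's inline Rel, KZOver.mem_relations_iff_toRaw_mem), then so does the
real base change of c. Transcendence-free (a certificate already forces KZ.eval c = 0:
PiSplit.eval_eq_zero_of_bc_piRep_mul); it is the effective-versus-localised seam of every structural
method (KontsevichZagier2001 §4.1; HuberWustholz2022 App. A.3–A.4 'we do not know if it is full';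
AyoubRelKZRevisited Rem. 1.3) WITH REAL INTERMEDIATE DATA ADMISSIBLE — scissors cuts at
transcendental heights, the real rescalings (σ,f) ↦ (λσ, f(·/λ)) and (σ,f) ↦ (σ, λ·f) (which map
each of the four real move sets into itself), fibrewise specialisation of the two disc coordinates
at ANY real point. CALIBRATION (kernel-checked, Cruxes/RealKZ/PiSplit.lean): Rea -/
@[route_item "route-KontsevichZagierPeriods-DefinableMoves"]
def RealPiCancellation : Prop :=
  ∀ c : Literature.NumberTheory.Transcendental.KZ.FormalRep, Literature.NumberTheory.Transcendental.KZOver.baseChange ℚ ℝ (Literature.NumberTheory.Transcendental.KZOver.equivKZ (Literature.NumberTheory.Transcendental.KZ.of Literature.NumberTheory.Transcendental.KZ.piRep * c)) ∈ Literature.NumberTheory.Transcendental.KZOver.relations ℝ → Literature.NumberTheory.Transcendental.KZOver.baseChange ℚ ℝ (Literature.NumberTheory.Transcendental.KZOver.equivKZ c) ∈ Literature.NumberTheory.Transcendental.KZOver.relations ℝ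

-- item stmt-KontsevichZagierPeriods-5850 · crux (kind.auto-crux: conjecture-grade) · rank 9 · open · by planner — informal only, no Lean statement yet:
--   [support][informal — to be typed over the requested KZ.Coeff k plus a SHAPE grading of chains (≤ N
--   move instances, polynomial data of degree ≤ N in ≤ N polynomials, real coefficients free) = this
--   route's BoundedChainLocus E_N] TEMPLATE COMPLEXITY IS UNBOUNDED AT SPECIAL FIBRES — quantitative
--   form of 'chain complexity jumps at special fibres' (card transcendence-runs-the-calculus-backwards
--   (2),(3); triage-13: 'definable-move (S) made quantitative'). For a ℚ-family pair (r_a),(r′_b) put E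
--   := {v(r_a) = v(r′_b)} and E_N ⊆ E the locus of pairs joined by an ℝ-coefficient chain of shape ≤ N
--   (ℚ-semial

/-- item stmt-KontsevichZagierPeriods-0541 · support · rank 8 · open · by planner
why it might fail: Period-conjecture strength (Ayoub2014 Cor. 32, HMS Prop. 13.2.6): with π-cancellation it yields algebraic independence of ζ(3), ζ(5), …; torsor/Nori methods give relations in Nori's presentation only, and their transfer into the four moves is unproved.
sources: Ayoub2014, HuberMullerStachPeriods2017, AyoubRelKZRevisited, KontsevichZagier2001
PiLocalKernel := ∀ c : Literature.NumberTheory.Transcendental.KZ.FormalRep,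
Literature.NumberTheory.Transcendental.KZ.eval c = 0 → ∃ N : ℕ, (of piRep)^⋆N ⋆ c ∈
Literature.NumberTheory.Transcendental.KZ.relations. This is the half of S reachable by torsor
arguments: Grothendieck's period conjecture gives injectivity of P̃ = P̃^eff[(2πi)⁻¹] → ℂ (route
Grothendieck, 0279), and a transfer of Nori/cohomological relators into KZ.relations (route
NoriTransfer, 0194/0198) then yields (2πi)^{2N}·c = (−4π²)^N·c ∈ relations WITHOUT needing
injectivity of P̃^eff → P̃; Ayoub's rigid-analytic computation of the Betti–de Rham torsor
(Ayoub2015 §3.6, AyoubRelKZRevisited Thm 1.11) is the model argument and works precisely after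
inverting 2πi. Open (≈ GPC-strength); filed so that provers/refuters see the effective/localised
distinction explicitly and so that a proof of #2′ collapses the problem to this item.
[needs_definition: KZ.prodRep / piRep / PiLocalKernel (def request this session); sources:
AyoubRelKZRevisited, Ayoub2015, HuberMullerStach2017] -/
@[route_item "route-KontsevichZagierPeriods-DefinableMoves"]
def AyoubPiLocalKernel : Prop :=
  ∀ (P : ∀ n : ℕ, Literature.NumberTheory.Transcendental.KZ.IntegralRep n → Literature.NumberTheory.Transcendental.KZ.IntegralRep (n + 2)), (∀ (n : ℕ) (r : Literature.NumberTheory.Transcendental.KZ.IntegralRep n), (P n r).domain = {z : Fin (n + 2) → ℝ | z 0 ^ 2 + z 1 ^ 2 ≤ 1 ∧ (fun i : Fin n => z i.succ.succ) ∈ r.domain} ∧ (P n r).integrand = fun z => r.integrand (fun i : Fin n => z i.succ.succ)) → ∀ c : Literature.NumberTheory.Transcendental.KZ.FormalRep, Literature.NumberTheory.Transcendental.KZ.eval c = 0 → ∃ N : ℕ, (⇑(FreeAbelianGroup.lift (fun s : (Σ n, Literature.NumberTheory.Transcendental.KZ.IntegralRep n) => Literature.NumberTheory.Transcendental.KZ.of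 (P s.1 s.2))))^[N] c ∈ Literature.NumberTheory.Transcendental.KZ.relations

/-- item stmt-KontsevichZagierPeriods-14462 · support · rank 9 · closed · proved by Summit.KontsevichZagierPeriods.DefinableMoves.RealKZOfVolumes.realKZOfVolumes_proof @ 467ccd87f29d (prover) · by planner
sources: CressonViusos2022, ViuSos2021, KontsevichZagier2001
[support] GLUE reaching the target (operator route-choice (a), 2026-08-16; gate hint `Crux… → RealKZ
(kind support)`): the real volume form implies RealKZ. Provable NOW — proof checked sorry-free (lean
check rc 0) in the planner folder GlueProof.lean, ≈ 70 lines, to be re-landed under Theorems/: (i)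
RealKZ ↔ ∀ ℚ-rational r, r′ of equal value, KZOver.Equivalent (KZOver.IntegralRep.ofKZOver ℝ r)
(KZOver.IntegralRep.ofKZOver ℝ r′) — the inline `let` Rel of RealKZ is DEFINITIONALLY KZOver.Raw.Rel
(Iff.rfl) and incl = KZOver.toRaw ∘ KZOver.baseChange ℚ ℝ ∘ KZOver.equivKZ on generators (rfl;
FreeAbelianGroup.lift_ext), then KZOver.mem_relations_iff_toRaw_mem and map_sub; (ii)
Cresson–Viu-Sos over ℚ, verbatim the tree's KZ.kzPeriodConjecture'_of_volumeConjectureCompact: [r] ≡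
[A] − [B], [r′] ≡ [A′] − [B′] mod KZ.relations with compact top-dimensional volume representations
(KZ.IntegralRep.exists_sub_volumeRep_mem_relations_of_semiCanonicalReduction
KZ.semiCanonicalReduction_holds), raise the four to one dimension
(exists_volumeRep_equivalent_of_le), glue M₁ ≡ [A] + [B′], M₂ ≡ [A′] + [B]
(exists_volumeRep_of_add_sub_of_mem_relations), vol M₁ = vol M₂ by soundness
(KZ.eval_eq_zero_of_mem_re -/
@[route_item "route-KontsevichZagierPeriods-DefinableMoves"]
def RealKZOfVolumes : Prop :=
  RealVolumeConjecture → RealKZ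

-- `RealKZOfVolumes` holds: proved by `Summit.KontsevichZagierPeriods.DefinableMoves.RealKZOfVolumes.realKZOfVolumes_proof` @ 467ccd87f29d (its module imports this route file, so no `_holds` link can be stated here).

/-- item stmt-KontsevichZagierPeriods-4090 · support · rank 9 · closed · proved by Summit.KontsevichZagierPeriods.DefinableMoves.algebraicPoints_proof @ 10732779cd56 (prover) · by planner
sources: BasuPollackRoy2006, Tarski1951, BochnakCosteRoy1998
[support] ℝ_alg ≺ ℝ, existential case: a nonempty ℚ-semialgebraic subset of ℝⁿ contains a point with
all coordinates algebraic over ℚ. Provable now from the tree: induct on n with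
tarski_seidenberg_real_holds (project, pick an algebraic point below by IH, the fibre is
semialgebraic over ℚ(a) ⊆ ℝ_alg, and a nonempty semialgebraic subset of ℝ defined over ℝ_alg is a
finite union of points/intervals with algebraic endpoints — normal form
isSemialgebraic_iff_exists_finset_basic_holds, roots of polynomials with algebraic coefficients are
algebraic); or via real_isOMinimal_holds / definable Skolem functions. Used by Transfer,
IntegrabilityLocus (iv), CovTransfer; reusable by cards real-coefficient-period-germs,
chains-have-standard-parts. Sources: BasuPollackRoy2006 §2.5, Tarski1951, BochnakCosteRoy1998.
[difficulty: M] -/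
@[route_item "route-KontsevichZagierPeriods-DefinableMoves"]
def AlgebraicPoints : Prop :=
  ∀ {n : ℕ} (S : Set (Fin n → ℝ)), Literature.ModelTheory.ExponentialFields.IsSemialgebraic ℚ S → S.Nonempty → ∃ x ∈ S, ∀ i, IsAlgebraic ℚ (x i)

-- `AlgebraicPoints` holds: proved by `Summit.KontsevichZagierPeriods.DefinableMoves.algebraicPoints_proof` @ 10732779cd56 (its module imports this route file, so no `_holds` link can be stated here).

/-- item stmt-KontsevichZagierPeriods-4091 · support · rank 9 · closed · proved by Summit.KontsevichZagierPeriods.DefinableMoves.algebraicCoefficients_proof @ 08cf65c9d381 (prover) · by planner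
sources: KontsevichZagier2001, BochnakCosteRoy1998, BasuPollackRoy2006
[support] Semialgebraic over the real algebraic numbers ⇒ semialgebraic over ℚ (KontsevichZagier2001
§1.1 'rational may be replaced by algebraic'; KZCalculus design note 'real algebraic parameters are
ℚ-definable'). Proof: each coefficient α ∈ integralClosure ℚ ℝ is ∅-definable in (ℝ,+,·,≤) as 'the
j-th root of its minimal polynomial', so an ℝ_alg-semialgebraic set is ℚ-definable, hence
ℚ-semialgebraic by definable_iff_isSemialgebraic_real_holds; the function/map versions follow
(graphs). Sources: KontsevichZagier2001 §1.1, BochnakCosteRoy1998, BasuPollackRoy2006. [difficulty: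
M] -/
@[route_item "route-KontsevichZagierPeriods-DefinableMoves"]
def AlgebraicCoefficients : Prop :=
  ∀ {n : ℕ} (S : Set (Fin n → ℝ)), Literature.ModelTheory.ExponentialFields.IsSemialgebraic (↥(integralClosure ℚ ℝ)) S → Literature.ModelTheory.ExponentialFields.IsSemialgebraic ℚ S

-- `AlgebraicCoefficients` holds: proved by `Summit.KontsevichZagierPeriods.DefinableMoves.algebraicCoefficients_proof` @ 08cf65c9d381 (its module imports this route file, so no `_holds` link can be stated here).

/-- item stmt-KontsevichZagierPeriods-4092 · support · rank 9 · closed · proved by Summit.KontsevichZagierPeriods.DefinableMoves.nullIffEmptyInterior_proof @ 8b7ca66b122a (prover) · by planner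
sources: BochnakCosteRoy1998
[support] For a ℚ-semialgebraic A ⊆ ℝⁿ: volume A = 0 ↔ interior A = ∅ — makes the side condition
`volume (σ₁ ∩ σ₂) = 0` of domainAddRel first-order. Proof: ⇐ tree
IsSemialgebraic.subset_interior_union (A ⊆ interior A ∪ finitely many proper zero sets) + zero sets
of nonzero polynomials are Lebesgue-null (Fubini induction); ⇒ a nonempty open set has positive
volume. n = 0: both sides false for A = univ (the point has volume 1), both true for ∅. Sources:
BochnakCosteRoy1998 §2.8, tree SemialgebraicInterior. [difficulty: S] -/
@[route_item "route-KontsevichZagierPeriods-DefinableMoves"]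
def NullIffEmptyInterior : Prop :=
  ∀ {n : ℕ} (A : Set (Fin n → ℝ)), Literature.ModelTheory.ExponentialFields.IsSemialgebraic ℚ A → (MeasureTheory.volume A = 0 ↔ interior A = ∅)

-- `NullIffEmptyInterior` holds: proved by `Summit.KontsevichZagierPeriods.DefinableMoves.nullIffEmptyInterior_proof` @ 8b7ca66b122a (its module imports this route file, so no `_holds` link can be stated here).

/-- item stmt-KontsevichZagierPeriods-4093 · support · rank 9 · closed · proved by Summit.KontsevichZagierPeriods.DefinableMoves.CovTransfer_proof @ da8ec34d818c (prover) · by planner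
sources: KontsevichZagier2001, BasuPollackRoy2006
[support] Calibration of Transfer INSIDE the existing calculus: a change of variables along an
ℝ-semialgebraic map Φ (real parameters allowed) between two ℚ-representations, with the exact side
conditions of KZ.changeOfVariablesRel, is already a KZ-equivalence. Proof = the Transfer argument
with no integrability input: normalise; Φ = Ψ(·, d₀) for a ℚ-family Ψ; T = {d | Ψ_d is a map on σ
with (∀ x ∈ σ ∃ matrix L, HasFDerivWithinAt Ψ_d L σ x ∧ f x = f'(Ψ_d x)·|det L|), injective on σ,
Ψ_d '' σ = σ'} is ℚ-definable (ε-δ) and contains d₀; AlgebraicPoints gives an algebraic d₁ ∈ T;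
AlgebraicCoefficients makes Ψ_{d₁} ℚ-semialgebraic; then [r] − [r'] ∈ changeOfVariablesRel. A cheap
end-to-end test of the definability-of-derivative bookkeeping. Sources: KontsevichZagier2001 §1.2
rule 2, BasuPollackRoy2006. [deps: AlgebraicPoints, AlgebraicCoefficients] [difficulty: M] -/
@[route_item "route-KontsevichZagierPeriods-DefinableMoves"]
def CovTransfer : Prop :=
  ∀ {n : ℕ} (r r' : Literature.NumberTheory.Transcendental.KZ.IntegralRep n) (Φ : (Fin n → ℝ) → (Fin n → ℝ)) (Φ' : (Fin n → ℝ) → (Fin n → ℝ) →L[ℝ] (Fin n → ℝ)), Literature.NumberTheory.Transcendental.IsSemialgebraicMapOn ℝ r.domain Φ → (∀ x ∈ r.domain, HasFDerivWithinAt Φ (Φ' x) r.domain x) → Set.InjOn Φ r.domain → r'.domain = Φ '' r.domain → (∀ x ∈ r.domain, r.integrand x = r'.integrand (Φ x) * |(Φ' x).det|) → Literature.NumberTheory.Transcendental.KZ.Equivalent r r'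

-- `CovTransfer` holds: proved by `Summit.KontsevichZagierPeriods.DefinableMoves.CovTransfer_proof` @ da8ec34d818c (its module imports this route file, so no `_holds` link can be stated here).

/-- item stmt-KontsevichZagierPeriods-5830 · support · rank 9 · closed · proved by Summit.KontsevichZagierPeriods.DefinableMoves.CircleSquaring.circleSquaringImpossible_proof @ 4992655c12db (prover) · by planner
[support] ALGEBRAIC SCISSORS CANNOT SQUARE THE CIRCLE (card
transcendence-runs-the-calculus-backwards (1), dcl(∅) form; = this route's announced
BoundedChainLocus corollary 'unit disc vs (0,π)×(0,1)', typed TODAY at the change-of-variables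
layer; needs NO IntegrabilityLocus: integrand 1, bounded sets). For no M is there an ℝ-semialgebraic
s of full measure in (open unit disc)×[0,1]^M and an ℝ-semialgebraic Φ, injective on s,
differentiable within s with |det Φ′| = 1, whose image is a full-measure subset of
(0,π)×(0,1)×[0,1]^M: the ℝ-coefficient analogue of ScissorsTransport.StableSetTransport FAILS for
this equal-volume pair (real parameters and stabilisation allowed; a finite chain of scissors +
volume-preserving semialgebraic maps composes to one such Φ modulo null cut loci). Proof plan
(bookkeeping as in CovTransfer): fix a template T (number/degrees of the polynomials describing s
and graph Φ; coefficients = a real vector c); Valid(λ,c) := 'c describes a stable transport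
disc-cylinder → (0,λ)×(0,1)-cylinder' is first-order over (ℝ,+,·,≤) WITHOUT parameters (⊆, InjOn;
HasFDerivWithinAt by ε-δ with ∀x∃L; |det L| = 1; null complement ⟺ empty interior as in
NullIffEmptyInterior ove -/
@[route_item "route-KontsevichZagierPeriods-DefinableMoves"]
def CircleSquaringImpossible : Prop :=
  ¬ ∃ (M : ℕ) (s : Set (Fin (2 + M) → ℝ)) (Φ : (Fin (2 + M) → ℝ) → (Fin (2 + M) → ℝ)) (Φ' : (Fin (2 + M) → ℝ) → (Fin (2 + M) → ℝ) →L[ℝ] (Fin (2 + M) → ℝ)), s ⊆ {z | z (Fin.castAdd M 0) ^ 2 + z (Fin.castAdd M 1) ^ 2 < 1 ∧ ∀ j : Fin M, z (Fin.natAdd 2 j) ∈ Set.Icc (0:ℝ) 1} ∧ MeasureTheory.volume ({z : Fin (2 + M) → ℝ | z (Fin.castAdd M 0) ^ 2 + z (Fin.castAdd M 1) ^ 2 < 1 ∧ ∀ j : Fin M, z (Fin.natAdd 2 j) ∈ Set.Icc (0:ℝ) 1} \ s) = 0 ∧ Φ '' s ⊆ {z | z (Fin.castAdd M 0) ∈ Set.Ioo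 0 Real.pi ∧ z (Fin.castAdd M 1) ∈ Set.Ioo (0:ℝ) 1 ∧ ∀ j : Fin M, z (Fin.natAdd 2 j) ∈ Set.Icc (0:ℝ) 1} ∧ MeasureTheory.volume ({z : Fin (2 + M) → ℝ | z (Fin.castAdd M 0) ∈ Set.Ioo 0 Real.pi ∧ z (Fin.castAdd M 1) ∈ Set.Ioo (0:ℝ) 1 ∧ ∀ j : Fin M, z (Fin.natAdd 2 j) ∈ Set.Icc (0:ℝ) 1} \ Φ '' s) = 0 ∧ Literature.ModelTheory.ExponentialFields.IsSemialgebraic ℝ s ∧ Literature.NumberTheory.Transcendental.IsSemialgebraicMapOn ℝ s Φ ∧ Set.InjOn Φ s ∧ (∀ x ∈ s, HasFDerivWithinAt Φ (Φ' x) s x) ∧ (∀ x ∈ s, |(Φ' x).det| = 1)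

-- `CircleSquaringImpossible` holds: proved by `Summit.KontsevichZagierPeriods.DefinableMoves.CircleSquaring.circleSquaringImpossible_proof` @ 4992655c12db (its module imports this route file, so no `_holds` link can be stated here).

/-- item stmt-KontsevichZagierPeriods-4086 · assembly · rank 1 · closed · proved by Summit.KontsevichZagierPeriods.DefinableMoves.assembly_proof @ 693c96ac9506 (prover) · by planner
sources: KontsevichZagier2001
[assembly] IntegrabilityLocus → Transfer → RealKZ → KontsevichZagierPeriods. Pure logic: `fun _ hT
hR _ _ r r' hr hr' hv => hT _ (hR r r' hr hr' hv)` typechecks in the planner's Sketch.lean (the two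
inline copies of the ℝ-calculus are syntactically identical, so definitional unfolding matches
them). IntegrabilityLocus is listed first because it is the unvendored printed fact the line rests
on. Sources: KontsevichZagier2001. -/
@[route_item "route-KontsevichZagierPeriods-DefinableMoves"]
def Assembly : Prop :=
  IntegrabilityLocus → Transfer → RealKZ → KontsevichZagierPeriods

-- `Assembly` holds: proved by `Summit.KontsevichZagierPeriods.DefinableMoves.assembly_proof` @ 693c96ac9506 (its module imports this route file, so no `_holds` link can be stated here).

/-! D-0027 §2.1 — DECIDING THEOREM (planner-authored via `route open/edit --closes-file`; by planner-rbadge-KontsevichZagierPeriods-Definab-3a87083b-g2-0 2026-08-15T16:14:08Z):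
its hypotheses are this route's items and its conclusion the sub-problem Statement (glue_lint), and it elaborates with this file. -/

/-- Route glue (D-0027 §2.1, deciding theorem). Pure logic over the two inline copies of the
real-coefficient calculus (syntactically identical `let`-prefixes in `RealKZ` and `Transfer`, so
`let`-unfolding matches them): for ℚ-rational `r`, `r'` of equal value, `RealKZ` puts
`incl ([r] − [r'])` into the ℝ-move group `Rel`, and `Transfer` pulls it back into `KZ.relations`,
which is `KZ.Equivalent r r'` by definition (`KZ.Equivalent r r' := of r - of r' ∈ relations`).
`IntegrabilityLocus` is carried as the route's first listed input — the printed-but-unvendored fact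
(ℚ-semialgebraicity of L¹-loci) on which the proof of `Transfer` rests; the deduction itself does not
consume it. -/
@[closes "route-KontsevichZagierPeriods-DefinableMoves"] theorem closes : IntegrabilityLocus → Transfer → RealKZ → KontsevichZagierPeriods :=
  fun _ hT hR _ _ r r' hr hr' hv => hT _ (hR r r' hr hr' hv)

end Summit.KontsevichZagierPeriods.KontsevichZagierPeriods.Theses.DefinableMoves
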